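import Literature.Analysis.ODE.CompactSupportFlow
import Literature.Analysis.ODE.FlowWithin
import Literature.Analysis.FunctionSpaces.TorusCalculusProofs
import Literature.Analysis.FunctionSpaces.TorusSpaceTime
import Literature.Analysis.FunctionSpaces.TorusHolderBridge
import Literature.Analysis.FunctionSpaces.HolderNormTorusProofs
import Literature.Analysis.FunctionSpaces.FlatTorusProofs
import HarnessLib

/-!
# Backward flows of smooth velocity fields on `[0,T] × T^d` (transport of the identity)

For a velocity field `v` on the flat torus `T^d = ℝ^d/ℤ^d`, jointly smooth on a closed time slab
`[0,T] × T^d` (`Torus.IsSmoothSpaceTimeOn (Icc 0 T) v`, derivatives within the slab), and an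
anchor time `t₀ ∈ [0,T]`, the **backward flow** `Φ(t, ·)` — the position at time `t₀` of the
particle that sits at `x` at time `t`, i.e. `Φ(t, ·) = X(t₀; t, ·)` with `X` the flux of `v` — is
the unique solution of the transport problem

  `(∂ₜ + v·∇) Φ = 0`,  `Φ(t₀, ·) = id`.

This is the object "`Φᵢ`, the backward flow of `v̄_q` with `Φᵢ(x, tᵢ) = x`" of the convex
integration schemes for Euler (Buckmaster–De Lellis–Székelyhidi–Vicol 2019, §5.2; App. B: "`Φ(t,·)`
the inverse of the flux `X` of `v` starting at time `t₀` as the identity", "we will consider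
solutions on the entire space `ℝ³` and treat solutions on the torus simply as periodic solutions in
`ℝ³`"). The main theorem `Literature.Analysis.ODE.exists_smooth_backwardFlow` PROVES its
existence in the form consumed there: a displacement `D = Φ - id : [0,T] × T^d → ℝ^d`, jointly
smooth on the slab, with `D(t₀, ·) = 0` and `∂ₜ D + (v·∇) D + v = 0` on `[0,T] × T^d` (the
transport equation for `Φ = id + D`, as `(v·∇) id = v`; one-sided time derivative
`Torus.timeDerivWithin (Icc 0 T)` at the ends of the slab).

## The proof (Lang 1995, Ch. IV §1: time-dependent fields as autonomous fields on `ℝ × E`, p. 61;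
## Thms. 1.15–1.16)

* `IsSmoothSpaceTimeOn.exists_lipschitzOnWith_stLift`: the lift `ṽ = stLift v : [0,T] × ℝ^d → ℝ^d`
  is Lipschitz on the slab (bounded spatial partial derivatives and periodicity give a spatial Lipschitz constant
  uniform in time, `Torus.lipschitzWith_of_norm_partialDeriv_le`; the bounded one-sided time
  derivative gives a temporal one, by the mean value inequality on `[0,T]`).
* `BackwardFlow.clampedLift hT v (t, y) = ṽ(t ∧ T ∨ 0, y)` (the time clamped to `[0,T]` by
  Mathlib's `Set.projIcc`) is a globally Lipschitz, bounded field on `ℝ × ℝ^d`, equal to `ṽ` on the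
  slab and lattice periodic; its suspension `(1, clampedLift)` (`Literature.Analysis.ODE.suspension`,
  with `lipschitzWith_suspension`, `norm_suspension_le`) has a global flow `Ψ`
  (`Literature.Analysis.ODE.globalFlow`: existence, group law, uniqueness) whose first coordinate
  is `t + r` (`BackwardFlow.fst_globalFlow_suspension`) and which commutes with lattice
  translations (`BackwardFlow.globalFlow_suspension_add_single`, by uniqueness).
* `BackwardFlow.contDiffOn_globalFlow_suspension`: on the slab flow domain
  `BackwardFlow.slabDomain T = {((t, y), r) : t, t + r ∈ [0,T]}` (convex with nonempty interior)
  `Ψ` is a flow *within* the slab of the field `(1, ṽ)`, which is `C^∞` there; hence `Ψ` is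
  jointly `C^∞` there by `IsFlowWithin.contDiffOn` (`Literature/Analysis/ODE/FlowWithin.lean`,
  Lang Thm. 1.16 within a convex set) — no extension of `v` beyond `[0,T]` is needed.
* `BackwardFlow.backwardLift … t₀ (t, y) = (Ψ (t, y) (t₀ - t)).2` is the lifted backward map:
  smooth on the slab (`contDiffOn_backwardLift`), the identity at `t₀`, lattice-equivariant, and
  constant along the flow (`backwardLift_globalFlow`, the group law), whence its derivative
  within the slab kills `(1, ṽ)` (`fderivWithin_backwardLift_suspension`, chain rule within
  sets); descending the periodic displacement to the torus (`Torus.descend`,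
  `Torus.lift_descend_holds`) and reading the torus derivatives through the lift
  (`IsSmoothSpaceTimeOn.timeDerivWithin_apply_proj`, `IsSmoothSpaceTimeOn.fderiv_slice_apply`)
  gives the theorem. The construction-specific helpers live in the sub-namespace
  `Literature.Analysis.ODE.BackwardFlow`; only the main theorem is at top level.

## References

* T. Buckmaster, C. De Lellis, L. Székelyhidi Jr., V. Vicol, *Onsager's conjecture for admissible
  weak solutions*, Comm. Pure Appl. Math. 72 (2019) = arXiv:1701.08678, §5.2 (backward flows
  `Φᵢ`), App. B (transport equations; `Φ` the inverse of the flux). [`BuckmasterEtAl2018`]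
* S. Lang, *Differential and Riemannian Manifolds*, GTM 160 (1995), Ch. IV §1, p. 61 and
  Thms. 1.15–1.16. [`Lang1995`]
-/

open Set Metric Filter
open scoped NNReal ContDiff Topology

noncomputable section

namespace Literature.Analysis.ODE

open Literature.Analysis.FunctionSpaces Literature.Analysis.FunctionSpaces.Torus

variable {d : Type*} [Fintype d]

/-! ## Lipschitz bounds for the lift of a jointly smooth field on `[0,T] × T^d` -/

section Lipschitz

variable {F : Type*} [NormedAddCommGroup F] [NormedSpace ℝ F]

/-- A field jointly smooth on `[0,T] × T^d` (`T > 0`) has a space–time lift that is Lipschitz on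
`[0,T] × ℝ^d` (mean value inequalities in space, through bounded partial derivatives and
periodicity, and in time, through the bounded one-sided time derivative). [folklore] -/
theorem _root_.Literature.Analysis.FunctionSpaces.Torus.IsSmoothSpaceTimeOn.exists_lipschitzOnWith_stLift
    [DecidableEq d] {T : ℝ} (hT : 0 < T) {v : ℝ → UnitAddTorus d → F}
    (hv : IsSmoothSpaceTimeOn (Icc 0 T) v) :
    ∃ K : ℝ≥0, LipschitzOnWith K (stLift v) (Icc 0 T ×ˢ univ) := by
  have hS : UniqueDiffOn ℝ (Icc 0 T) := uniqueDiffOn_Icc hT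
  -- spatial Lipschitz constant, uniform in time
  have hM : ∀ i : d, ∃ C : ℝ, ∀ t ∈ Icc 0 T, ∀ x, ‖partialDeriv i (v t) x‖ ≤ C := fun i =>
    (hv.partialDeriv hS i).exists_norm_le_of_isCompact isCompact_Icc subset_rfl
  choose M hM using hM
  set K₁ : ℝ≥0 := NNReal.sqrt (Fintype.card d) * ∑ i, Real.toNNReal (M i) with hK₁
  have hspace : ∀ t ∈ Icc 0 T, LipschitzWith K₁ (v t) := fun t ht =>
    lipschitzWith_of_norm_partialDeriv_le ((hv.isSmooth_slice ht).isContDiff (by simp))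
      (M := fun i => Real.toNNReal (M i)) fun i x => (hM i t ht x).trans (Real.le_coe_toNNReal _)
  -- temporal Lipschitz constant, uniform in space
  obtain ⟨Ct, hCt⟩ := (hv.timeDerivWithin hS).exists_norm_le_of_isCompact isCompact_Icc subset_rfl
  have htime : ∀ x, ∀ s ∈ Icc 0 T, ∀ s' ∈ Icc 0 T, ‖v s' x - v s x‖ ≤ Ct * ‖s' - s‖ :=
    fun x s hs s' hs' =>
      (convex_Icc 0 T).norm_image_sub_le_of_norm_hasDerivWithin_le
        (fun τ hτ => hv.hasDerivWithinAt_slice hτ x) (fun τ hτ => hCt τ hτ x) hs hs'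
  refine ⟨K₁ + Real.toNNReal Ct, LipschitzOnWith.of_dist_le_mul fun p hp q hq => ?_⟩
  obtain ⟨s, y⟩ := p
  obtain ⟨s', y'⟩ := q
  have hs : s ∈ Icc 0 T := (mem_prod.1 hp).1
  have hs' : s' ∈ Icc 0 T := (mem_prod.1 hq).1
  rw [stLift_apply, stLift_apply, dist_eq_norm]
  have h1 : ‖v s (proj y) - v s (proj y')‖ ≤ K₁ * ‖y - y'‖ := by
    have := (hspace s hs).dist_le_mul (proj y) (proj y')
    rw [dist_eq_norm] at this
    refine this.trans (mul_le_mul_of_nonneg_left ?_ K₁.2)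
    have hp := lipschitzWith_proj.dist_le_mul y y'
    rwa [NNReal.coe_one, one_mul, dist_eq_norm y y'] at hp
  have h2 : ‖v s (proj y') - v s' (proj y')‖ ≤ Ct * ‖s - s'‖ := htime (proj y') s' hs' s hs
  have hn1 : ‖y - y'‖ ≤ ‖((s, y) : ℝ × EuclideanSpace ℝ d) - (s', y')‖ :=
    norm_snd_le (((s, y) : ℝ × EuclideanSpace ℝ d) - (s', y'))
  have hn2 : ‖s - s'‖ ≤ ‖((s, y) : ℝ × EuclideanSpace ℝ d) - (s', y')‖ :=
    norm_fst_le (((s, y) : ℝ × EuclideanSpace ℝ d) - (s', y'))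
  calc ‖v s (proj y) - v s' (proj y')‖
      = ‖(v s (proj y) - v s (proj y')) + (v s (proj y') - v s' (proj y'))‖ := by abel_nf
    _ ≤ ‖v s (proj y) - v s (proj y')‖ + ‖v s (proj y') - v s' (proj y')‖ := norm_add_le _ _
    _ ≤ K₁ * ‖y - y'‖ + Ct * ‖s - s'‖ := add_le_add h1 h2
    _ ≤ K₁ * ‖((s, y) : ℝ × EuclideanSpace ℝ d) - (s', y')‖ +
        Real.toNNReal Ct * ‖((s, y) : ℝ × EuclideanSpace ℝ d) - (s', y')‖ := by
        refine add_le_add (mul_le_mul_of_nonneg_left hn1 K₁.2) ?_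
        exact mul_le_mul (Real.le_coe_toNNReal Ct) hn2 (norm_nonneg _) (NNReal.coe_nonneg _)
    _ = ↑(K₁ + Real.toNNReal Ct) * dist ((s, y) : ℝ × EuclideanSpace ℝ d) (s', y') := by
        rw [dist_eq_norm, NNReal.coe_add]; ring

end Lipschitz

namespace BackwardFlow

/-! ## The clamped lift and its suspension `(1, v(t ∧ T ∨ 0, x))` on `ℝ × ℝ^d` -/

section Suspension

/-- The lift of `v` with the time clamped to `[0,T]` (Mathlib's `Set.projIcc`):
`(t, y) ↦ v(t ∧ T ∨ 0, proj y)`, a field on all of `ℝ × ℝ^d` which agrees with `stLift v` on the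
slab `[0,T] × ℝ^d`. [folklore] -/
def clampedLift {T : ℝ} (hT : 0 ≤ T) (v : ℝ → UnitAddTorus d → EuclideanSpace ℝ d)
    (p : ℝ × EuclideanSpace ℝ d) : EuclideanSpace ℝ d :=
  v (Set.projIcc 0 T hT p.1 : ℝ) (proj p.2)

variable {T : ℝ} {hT : 0 ≤ T} {v : ℝ → UnitAddTorus d → EuclideanSpace ℝ d}

omit [Fintype d] in
/-- On `[0,T] × ℝ^d` the clamped lift is `stLift v`. [folklore] -/
theorem clampedLift_of_mem {p : ℝ × EuclideanSpace ℝ d} (hp : p.1 ∈ Icc 0 T) :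
    clampedLift hT v p = stLift v p := by
  rw [clampedLift, Set.projIcc_of_mem hT hp, stLift]

omit [Fintype d] in
/-- The suspension of the clamped lift is `(1, stLift v)` on `[0,T] × ℝ^d`. [folklore] -/
theorem suspension_clampedLift_of_mem {p : ℝ × EuclideanSpace ℝ d} (hp : p.1 ∈ Icc 0 T) :
    suspension (clampedLift hT v) p = (1, stLift v p) := by
  rw [suspension_apply, clampedLift_of_mem hp]

omit [Fintype d] in
/-- The suspension of the clamped lift is invariant under unit lattice translations in space. [folklore] -/
theorem suspension_clampedLift_add_single [DecidableEq d] (p : ℝ × EuclideanSpace ℝ d) (j : d) :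
    suspension (clampedLift hT v) (p + (0, EuclideanSpace.single j 1)) =
      suspension (clampedLift hT v) p := by
  obtain ⟨t, y⟩ := p
  simp only [suspension_apply, clampedLift, Prod.mk_add_mk, add_zero]
  rw [show v (Set.projIcc 0 T hT t : ℝ) (proj (y + EuclideanSpace.single j 1)) =
      lift (v (Set.projIcc 0 T hT t : ℝ)) (y + EuclideanSpace.single j 1) from rfl,
    isLatticePeriodic_lift (v (Set.projIcc 0 T hT t : ℝ)) j y]
  rfl

/-- The clamped lift of a field jointly smooth on `[0,T] × T^d` is globally Lipschitz (the clamp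
`Set.projIcc` is `1`-Lipschitz, `Set.abs_projIcc_sub_projIcc`). [folklore] -/
theorem exists_lipschitzWith_clampedLift [DecidableEq d] (hT : 0 < T)
    (hv : IsSmoothSpaceTimeOn (Icc 0 T) v) :
    ∃ K : ℝ≥0, LipschitzWith K (clampedLift hT.le v) := by
  obtain ⟨K, hK⟩ := hv.exists_lipschitzOnWith_stLift hT
  refine ⟨K, LipschitzWith.of_dist_le_mul fun p q => ?_⟩
  have hp : ((Set.projIcc 0 T hT.le p.1 : ℝ), p.2) ∈ Icc 0 T ×ˢ (univ : Set (EuclideanSpace ℝ d)) :=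
    mk_mem_prod (Set.projIcc 0 T hT.le p.1).2 (mem_univ _)
  have hq : ((Set.projIcc 0 T hT.le q.1 : ℝ), q.2) ∈ Icc 0 T ×ˢ (univ : Set (EuclideanSpace ℝ d)) :=
    mk_mem_prod (Set.projIcc 0 T hT.le q.1).2 (mem_univ _)
  have h1 := hK.dist_le_mul _ hp _ hq
  have h2 : dist (((Set.projIcc 0 T hT.le p.1 : ℝ), p.2) : ℝ × EuclideanSpace ℝ d)
      ((Set.projIcc 0 T hT.le q.1 : ℝ), q.2) ≤ dist p q := by
    rw [Prod.dist_eq, Prod.dist_eq]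
    refine max_le_max ?_ le_rfl
    rw [Real.dist_eq, Real.dist_eq]
    exact Set.abs_projIcc_sub_projIcc hT.le
  rw [show dist (clampedLift hT.le v p) (clampedLift hT.le v q) =
      dist (stLift v ((Set.projIcc 0 T hT.le p.1 : ℝ), p.2))
        (stLift v ((Set.projIcc 0 T hT.le q.1 : ℝ), q.2)) from rfl]
  exact h1.trans (mul_le_mul_of_nonneg_left h2 K.2)

/-- The clamped lift of a field jointly smooth on `[0,T] × T^d` is bounded. [folklore] -/
theorem exists_bound_clampedLift (hT : 0 < T) (hv : IsSmoothSpaceTimeOn (Icc 0 T) v) :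
    ∃ B : ℝ, ∀ p, ‖clampedLift hT.le v p‖ ≤ B := by
  obtain ⟨C, hC⟩ := hv.exists_norm_le_of_isCompact isCompact_Icc subset_rfl
  exact ⟨C, fun p => hC _ (Set.projIcc 0 T hT.le p.1).2 _⟩

end Suspension

/-! ## The suspended flow, the backward map and the transport equation -/

section Backward

variable {T : ℝ} {hT : 0 ≤ T} {v : ℝ → UnitAddTorus d → EuclideanSpace ℝ d} {K : ℝ≥0} {L : ℝ}

/-- The first coordinate of the flow of the suspended field is `t + r`. [folklore] -/
theorem fst_globalFlow_suspension (hK : LipschitzWith K (suspension (clampedLift hT v)))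
    (hL : ∀ q, ‖suspension (clampedLift hT v) q‖ ≤ L) (p : ℝ × EuclideanSpace ℝ d) (r : ℝ) :
    (globalFlow hK hL p r).1 = p.1 + r := by
  have hderiv : ∀ s, HasDerivAt (fun s => (globalFlow hK hL p s).1 - s) ((1 : ℝ) - 1) s := by
    intro s
    have h1 := ((ContinuousLinearMap.fst ℝ ℝ (EuclideanSpace ℝ d)).hasFDerivAt).comp_hasDerivAt s
      (hasDerivAt_globalFlow hK hL p s)
    exact h1.sub (hasDerivAt_id s)
  have hconst := is_const_of_deriv_eq_zero (fun s => (hderiv s).differentiableAt)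
    (fun s => by rw [(hderiv s).deriv, sub_self]) r 0
  simp only [globalFlow_zero, sub_zero] at hconst
  linarith

/-- Lattice periodicity of the flow of the suspended field in the space variable. [folklore] -/
theorem globalFlow_suspension_add_single [DecidableEq d]
    (hK : LipschitzWith K (suspension (clampedLift hT v)))
    (hL : ∀ q, ‖suspension (clampedLift hT v) q‖ ≤ L) (p : ℝ × EuclideanSpace ℝ d) (j : d) (r : ℝ) :
    globalFlow hK hL (p + (0, EuclideanSpace.single j 1)) r =
      globalFlow hK hL p r + (0, EuclideanSpace.single j 1) := by
  set γ : ℝ → ℝ × EuclideanSpace ℝ d := fun s => globalFlow hK hL p s + (0, EuclideanSpace.single j 1)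
    with hγ
  have hγd : ∀ s ∈ Ioo (-(|r| + 1)) (|r| + 1),
      HasDerivAt γ (suspension (clampedLift hT v) (γ s)) s := by
    intro s _
    have h := (hasDerivAt_globalFlow hK hL p s).add_const (0, EuclideanSpace.single j 1)
    rwa [← suspension_clampedLift_add_single (globalFlow hK hL p s) j] at h
  have h0 : (0 : ℝ) ∈ Ioo (-(|r| + 1)) (|r| + 1) := ⟨by linarith [abs_nonneg r], by positivity⟩
  have hr : r ∈ Ioo (-(|r| + 1)) (|r| + 1) := by
    constructor <;> cases abs_cases r <;> linarith
  have h := eqOn_globalFlow hK hL h0 hγd hr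
  have hγ0 : γ 0 = p + (0, EuclideanSpace.single j 1) := by simp [hγ]
  rw [hγ0] at h
  exact h.symm

/-- Times between `t` and `t + r` stay in `[0,T]` when `t` and `t + r` do. [folklore] -/
theorem add_mem_Icc_of_mem_uIcc {T a b t : ℝ} (ha : a ∈ Icc 0 T) (hab : a + b ∈ Icc 0 T)
    (ht : t ∈ uIcc 0 b) : a + t ∈ Icc 0 T := by
  rw [mem_uIcc] at ht
  obtain ⟨ha0, haT⟩ := ha
  obtain ⟨hb0, hbT⟩ := hab
  rcases ht with ⟨h1, h2⟩ | ⟨h1, h2⟩ <;> constructor <;> linarith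

variable (T) in
/-- The domain `{((t, y), r) : t ∈ [0,T], t + r ∈ [0,T]}` of the two-parameter flow of a field on
the slab `[0,T] × ℝ^d` (initial point and elapsed time). [folklore] -/
def slabDomain : Set ((ℝ × EuclideanSpace ℝ d) × ℝ) :=
  {z | z.1.1 ∈ Icc 0 T ∧ z.1.1 + z.2 ∈ Icc 0 T}

omit [Fintype d] in
/-- Membership in the slab flow domain. [folklore] -/
theorem mem_slabDomain {z : (ℝ × EuclideanSpace ℝ d) × ℝ} :
    z ∈ slabDomain T ↔ z.1.1 ∈ Icc 0 T ∧ z.1.1 + z.2 ∈ Icc 0 T := Iff.rfl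

omit [Fintype d] in
/-- The slab flow domain is convex. [folklore] -/
theorem convex_slabDomain : Convex ℝ (slabDomain (d := d) T) := by
  let f₁ : (ℝ × EuclideanSpace ℝ d) × ℝ →ₗ[ℝ] ℝ :=
    (LinearMap.fst ℝ ℝ (EuclideanSpace ℝ d)).comp (LinearMap.fst ℝ (ℝ × EuclideanSpace ℝ d) ℝ)
  let f₂ : (ℝ × EuclideanSpace ℝ d) × ℝ →ₗ[ℝ] ℝ := f₁ + LinearMap.snd ℝ (ℝ × EuclideanSpace ℝ d) ℝ
  have h : slabDomain (d := d) T = f₁ ⁻¹' Icc 0 T ∩ f₂ ⁻¹' Icc 0 T := by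
    ext z; simp [slabDomain, f₁, f₂]
  rw [h]
  exact ((convex_Icc 0 T).linear_preimage f₁).inter ((convex_Icc 0 T).linear_preimage f₂)

/-- The slab flow domain has the unique differentiability property (`T > 0`: it is convex with
nonempty interior). [folklore] -/
theorem uniqueDiffOn_slabDomain (hT : 0 < T) : UniqueDiffOn ℝ (slabDomain (d := d) T) := by
  refine uniqueDiffOn_convex convex_slabDomain ⟨((T / 2, 0), 0), ?_⟩
  rw [mem_interior_iff_mem_nhds, Metric.mem_nhds_iff]
  refine ⟨T / 4, by positivity, fun z hz => ?_⟩
  rw [mem_ball, dist_eq_norm] at hz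
  have h1 : |z.1.1 - T / 2| < T / 4 := by
    have := (norm_fst_le (z - ((T / 2, 0), 0))).trans_lt hz
    have := (norm_fst_le (z - ((T / 2, 0), 0)).1).trans_lt (lt_of_le_of_lt le_rfl this)
    simpa [Real.norm_eq_abs] using this
  have h2 : |z.2| < T / 4 := by
    have := (norm_snd_le (z - ((T / 2, 0), 0))).trans_lt hz
    simpa [Real.norm_eq_abs] using this
  rw [abs_lt] at h1 h2
  exact ⟨⟨by linarith, by linarith⟩, ⟨by linarith, by linarith⟩⟩

/-- The flow of the suspended field stays in `[0,T] × ℝ^d` while the time stays in `[0,T]`. [folklore] -/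
theorem globalFlow_suspension_mem (hK : LipschitzWith K (suspension (clampedLift hT v)))
    (hL : ∀ q, ‖suspension (clampedLift hT v) q‖ ≤ L) {z : (ℝ × EuclideanSpace ℝ d) × ℝ}
    (hz : z ∈ slabDomain T) {r : ℝ} (hr : r ∈ uIcc 0 z.2) :
    globalFlow hK hL z.1 r ∈ Icc 0 T ×ˢ (univ : Set (EuclideanSpace ℝ d)) := by
  have h1 : (globalFlow hK hL z.1 r).1 ∈ Icc 0 T := by
    rw [fst_globalFlow_suspension]
    exact add_mem_Icc_of_mem_uIcc hz.1 hz.2 hr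
  exact mem_prod.2 ⟨h1, mem_univ _⟩

/-- **The two-parameter flow is jointly smooth** on the slab flow domain (a flow within the
convex set `[0,T] × ℝ^d` of the field `(1, stLift v)`, smooth there; `IsFlowWithin.contDiffOn`,
Lang 1995, IV §1, Thm. 1.16). [folklore] -/
theorem contDiffOn_globalFlow_suspension (hT' : 0 < T) (hv : IsSmoothSpaceTimeOn (Icc 0 T) v)
    (hK : LipschitzWith K (suspension (clampedLift hT v)))
    (hL : ∀ q, ‖suspension (clampedLift hT v) q‖ ≤ L) :
    ContDiffOn ℝ ∞ (fun z : (ℝ × EuclideanSpace ℝ d) × ℝ => globalFlow hK hL z.1 z.2)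
      (slabDomain T) := by
  have hflow : IsFlowWithin (fun q : ℝ × EuclideanSpace ℝ d => ((1 : ℝ), stLift v q))
      (Icc 0 T ×ˢ univ) (globalFlow hK hL) (slabDomain T) := by
    refine ⟨fun z _ => globalFlow_zero hK hL z.1, fun z hz r hr => ?_,
      fun z hz r hr => globalFlow_suspension_mem hK hL hz hr⟩
    have h := (hasDerivAt_globalFlow hK hL z.1 r).hasDerivWithinAt (s := uIcc 0 z.2)
    rwa [suspension_clampedLift_of_mem (mem_prod.1 (globalFlow_suspension_mem hK hL hz hr)).1] at h
  have hG : ContDiffOn ℝ ∞ (fun q : ℝ × EuclideanSpace ℝ d => ((1 : ℝ), stLift v q))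
      (Icc 0 T ×ˢ univ) := contDiffOn_const.prodMk hv
  exact hflow.contDiffOn ((convex_Icc 0 T).prod convex_univ)
    ((uniqueDiffOn_Icc hT').prod uniqueDiffOn_univ) (uniqueDiffOn_slabDomain hT') (by simp) hG

variable (hK : LipschitzWith K (suspension (clampedLift hT v)))
  (hL : ∀ q, ‖suspension (clampedLift hT v) q‖ ≤ L) (t₀ : ℝ)

/-- The lifted **backward map** `Φ(t, y) = X(t₀; t, y)`, the position at time `t₀` of the
integral curve of `v` passing through `y` at time `t` (second component of the suspended flow
after the elapsed time `t₀ - t`; BDSV §5.2, App. B "`Φ(t, ·)` the inverse of the flux `X` of `v`").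
[folklore] -/
def backwardLift (p : ℝ × EuclideanSpace ℝ d) : EuclideanSpace ℝ d :=
  (globalFlow hK hL p (t₀ - p.1)).2

/-- The backward map is invariant along the flow: `Φ(t + h, X(t + h; t, y)) = Φ(t, y)`
(group law of the suspended flow). [folklore] -/
theorem backwardLift_globalFlow (p : ℝ × EuclideanSpace ℝ d) (h : ℝ) :
    backwardLift hK hL t₀ (globalFlow hK hL p h) = backwardLift hK hL t₀ p := by
  unfold backwardLift
  rw [fst_globalFlow_suspension, ← globalFlow_add]
  congr 2
  ring

/-- The backward map is `id` at the anchor time. [folklore] -/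
theorem backwardLift_anchor (y : EuclideanSpace ℝ d) : backwardLift hK hL t₀ (t₀, y) = y := by
  simp [backwardLift]

/-- Lattice periodicity of the backward map: `Φ(t, y + e_j) = Φ(t, y) + e_j`. [folklore] -/
theorem backwardLift_add_single [DecidableEq d] (t : ℝ) (y : EuclideanSpace ℝ d) (j : d) :
    backwardLift hK hL t₀ (t, y + EuclideanSpace.single j 1) =
      backwardLift hK hL t₀ (t, y) + EuclideanSpace.single j 1 := by
  have h : ((t, y + EuclideanSpace.single j 1) : ℝ × EuclideanSpace ℝ d) =
      (t, y) + (0, EuclideanSpace.single j 1) := by simp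
  show (globalFlow hK hL (t, y + EuclideanSpace.single j 1) (t₀ - t)).2 =
    (globalFlow hK hL (t, y) (t₀ - t)).2 + EuclideanSpace.single j 1
  rw [h, globalFlow_suspension_add_single, Prod.snd_add]

/-- The backward map is smooth on `[0,T] × ℝ^d` for an anchor `t₀ ∈ [0,T]`. [folklore] -/
theorem contDiffOn_backwardLift (hT' : 0 < T) (hv : IsSmoothSpaceTimeOn (Icc 0 T) v)
    (ht₀ : t₀ ∈ Icc 0 T) : ContDiffOn ℝ ∞ (backwardLift hK hL t₀) (Icc 0 T ×ˢ univ) := by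
  have hΨ := contDiffOn_globalFlow_suspension hT' hv hK hL
  have hι : ContDiffOn ℝ ∞ (fun p : ℝ × EuclideanSpace ℝ d => (p, t₀ - p.1)) (Icc 0 T ×ˢ univ) :=
    contDiffOn_id.prodMk (contDiffOn_const.sub contDiffOn_fst)
  have hmaps : MapsTo (fun p : ℝ × EuclideanSpace ℝ d => (p, t₀ - p.1)) (Icc 0 T ×ˢ univ)
      (slabDomain T) := fun p hp =>
    ⟨(mem_prod.1 hp).1, by simpa using ht₀⟩
  exact (hΨ.comp hι hmaps).snd

/-- **The transport equation for the backward map**: the derivative of `Φ` within `[0,T] × ℝ^d`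
kills the suspended field, `DΦ(t, y)[(1, v(t, y))] = 0` (differentiate `h ↦ Φ(X_h(t, y))`, which
is constant by `backwardLift_globalFlow`). [folklore] -/
theorem fderivWithin_backwardLift_suspension (hT' : 0 < T) (hv : IsSmoothSpaceTimeOn (Icc 0 T) v)
    (ht₀ : t₀ ∈ Icc 0 T) {p : ℝ × EuclideanSpace ℝ d} (hp : p ∈ Icc 0 T ×ˢ (univ : Set _)) :
    fderivWithin ℝ (backwardLift hK hL t₀) (Icc 0 T ×ˢ univ) p (suspension (clampedLift hT v) p) = 0 := by
  have hp1 : p.1 ∈ Icc 0 T := (mem_prod.1 hp).1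
  set I : Set ℝ := Icc (-p.1) (T - p.1) with hI
  have hI0 : (0 : ℝ) ∈ I := ⟨by linarith [hp1.1], by linarith [hp1.2]⟩
  have hUI : UniqueDiffWithinAt ℝ I 0 := uniqueDiffOn_Icc (by linarith) 0 hI0
  have hmaps : MapsTo (globalFlow hK hL p) I (Icc 0 T ×ˢ univ) := by
    intro h hh
    have h1 : (globalFlow hK hL p h).1 ∈ Icc 0 T := by
      rw [fst_globalFlow_suspension]
      exact ⟨by linarith [hh.1], by linarith [hh.2]⟩
    exact mem_prod.2 ⟨h1, mem_univ _⟩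
  have hΦ : HasFDerivWithinAt (backwardLift hK hL t₀)
      (fderivWithin ℝ (backwardLift hK hL t₀) (Icc 0 T ×ˢ univ) p) (Icc 0 T ×ˢ univ)
      (globalFlow hK hL p 0) := by
    rw [globalFlow_zero]
    exact ((contDiffOn_backwardLift hK hL t₀ hT' hv ht₀).differentiableOn (by simp) p hp).hasFDerivWithinAt
  have hΨ : HasDerivWithinAt (globalFlow hK hL p) (suspension (clampedLift hT v) (globalFlow hK hL p 0)) I 0 :=
    (hasDerivAt_globalFlow hK hL p 0).hasDerivWithinAt
  have hcomp := hΦ.comp_hasDerivWithinAt (0 : ℝ) hΨ hmaps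
  rw [globalFlow_zero] at hcomp
  have hconst : backwardLift hK hL t₀ ∘ globalFlow hK hL p = fun _ => backwardLift hK hL t₀ p :=
    funext fun h => backwardLift_globalFlow hK hL t₀ p h
  rw [hconst] at hcomp
  exact hUI.eq_deriv _ hcomp (hasDerivWithinAt_const (0 : ℝ) I _)

end Backward

end BackwardFlow

/-! ## Backward flows on the torus -/

section Main

variable {T : ℝ} {v : ℝ → UnitAddTorus d → EuclideanSpace ℝ d}

/-- **Backward flows of smooth velocity fields on `[0,T] × T^d`.** For a velocity field `v`
jointly smooth on `[0,T] × T^d` (`T > 0`) and an anchor time `t₀ ∈ [0,T]`, the transport problem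
`(∂ₜ + v·∇) Φ = 0`, `Φ(t₀, ·) = id` has a solution on `[0,T] × T^d` of the form `Φ = id + D`
with `D : [0,T] × T^d → ℝ^d` jointly smooth: `D(t₀, ·) = 0` and
`∂ₜ D + (v·∇) D + v = 0` (one-sided time derivative within `[0,T]`). `Φ(t, ·)` is the
time-`t₀` map of the (backward) flow of `v` — the "backward flows `Φ_i`" of
Buckmaster–De Lellis–Székelyhidi–Vicol 2019, §5.2, anchored at `t_i`; App. B: "`Φ(t, ·)` the
inverse of the flux `X` of `v` starting at time `t₀` as the identity"; Lang 1995, IV §1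
(flows of time-dependent fields through the suspension `(1, v)`). Proof: global flow of the
globally Lipschitz suspension `(1, v(t ∧ T ∨ 0, ·))` on `ℝ × ℝ^d` (`Literature.Analysis.ODE.globalFlow`,
`Literature.Analysis.ODE.suspension`),
joint smoothness within `[0,T] × ℝ^d` (`IsFlowWithin.contDiffOn`), lattice periodicity by
uniqueness, and the chain rule along the flow. [folklore] -/
theorem exists_smooth_backwardFlow (hT : 0 < T) (hv : IsSmoothSpaceTimeOn (Icc 0 T) v) {t₀ : ℝ}
    (ht₀ : t₀ ∈ Icc 0 T) :
    ∃ D : ℝ → UnitAddTorus d → EuclideanSpace ℝ d,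
      IsSmoothSpaceTimeOn (Icc 0 T) D ∧ (∀ x, D t₀ x = 0) ∧
      ∀ t ∈ Icc 0 T, ∀ x, timeDerivWithin (Icc 0 T) D t x + convect (v t) (D t) x + v t x = 0 := by
  classical
  obtain ⟨K, hK⟩ := BackwardFlow.exists_lipschitzWith_clampedLift hT hv
  obtain ⟨B, hB⟩ := BackwardFlow.exists_bound_clampedLift hT hv
  have hK' := lipschitzWith_suspension hK
  have hL' : ∀ q, ‖suspension (BackwardFlow.clampedLift hT.le v) q‖ ≤ max 1 B :=
    norm_suspension_le hB
  have hS : UniqueDiffOn ℝ (Icc 0 T) := uniqueDiffOn_Icc hT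
  set Φ := BackwardFlow.backwardLift hK' hL' t₀ with hΦdef
  have hΦ : ContDiffOn ℝ ∞ Φ (Icc 0 T ×ˢ univ) :=
    BackwardFlow.contDiffOn_backwardLift hK' hL' t₀ hT hv ht₀
  -- the periodic displacement and its descent to the torus
  set Dl : ℝ → EuclideanSpace ℝ d → EuclideanSpace ℝ d := fun t y => Φ (t, y) - y with hDl
  have hper : ∀ t, IsLatticePeriodic (Dl t) := fun t j y => by
    simp only [hDl, hΦdef, BackwardFlow.backwardLift_add_single]
    abel
  let D : ℝ → UnitAddTorus d → EuclideanSpace ℝ d := fun t => descend (Dl t) (hper t)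
  have hlift : ∀ t y, D t (proj y) = Dl t y := fun t y => by
    have h := congrFun (lift_descend_holds (Dl t) (hper t)) y
    rwa [lift_apply] at h
  have hst : stLift D = fun p => Φ p - p.2 := funext fun p => hlift p.1 p.2
  have hD : IsSmoothSpaceTimeOn (Icc 0 T) D := by
    change ContDiffOn ℝ ∞ (stLift D) (Icc 0 T ×ˢ univ)
    rw [hst]
    exact hΦ.sub contDiffOn_snd
  refine ⟨D, hD, fun x => ?_, fun t ht x => ?_⟩
  · obtain ⟨y, rfl⟩ := proj_surjective x
    rw [hlift]
    simp [hDl, hΦdef, BackwardFlow.backwardLift_anchor]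
  · obtain ⟨y, rfl⟩ := proj_surjective x
    have hp : ((t, y) : ℝ × EuclideanSpace ℝ d) ∈ Icc 0 T ×ˢ (univ : Set (EuclideanSpace ℝ d)) :=
      mk_mem_prod ht (mem_univ _)
    have hU : UniqueDiffWithinAt ℝ (Icc 0 T ×ˢ (univ : Set (EuclideanSpace ℝ d))) (t, y) :=
      (hS.prod uniqueDiffOn_univ) _ hp
    rw [hD.timeDerivWithin_apply_proj hS ht y,
      show convect (v t) (D t) (proj y) = Torus.fderiv (D t) (proj y) (v t (proj y)) from rfl,
      hD.fderiv_slice_apply ht y, ← ContinuousLinearMap.map_add, Prod.mk_add_mk, add_zero, zero_add]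
    -- the derivative of `stLift D = Φ - snd`
    have hderiv : HasFDerivWithinAt (stLift D)
        (fderivWithin ℝ Φ (Icc 0 T ×ˢ univ) (t, y) -
          ContinuousLinearMap.snd ℝ ℝ (EuclideanSpace ℝ d)) (Icc 0 T ×ˢ univ) (t, y) := by
      rw [hst]
      exact ((hΦ.differentiableOn (by simp) _ hp).hasFDerivWithinAt).sub
        ((ContinuousLinearMap.snd ℝ ℝ (EuclideanSpace ℝ d)).hasFDerivAt.hasFDerivWithinAt)
    rw [hderiv.fderivWithin hU, FunLike.coe_sub, Pi.sub_apply, ContinuousLinearMap.coe_snd',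
      sub_add_cancel]
    have key := BackwardFlow.fderivWithin_backwardLift_suspension hK' hL' t₀ hT hv ht₀ hp
    rwa [BackwardFlow.suspension_clampedLift_of_mem ht, stLift_apply] at key

end Main

end Literature.Analysis.ODE
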